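import Summits.CriticalPhenomena.PercolationContinuityZ3.Theorems.Transplant.FKThreeApexT5Final

/-!
# Connectivity correlation inequalities for `φ_{w,q}`, `0 < q ≤ 1` — the three-apex monoid of `K_{1,1,1,n}`:
# the apex-`b` upper-envelope form `Φ_b` and the NATURAL-WEIGHT instances of `(U_a)`, `(U_b)` used by the T3 certificates

Helper file (`--supports stmt-CriticalPhenomena-4575`), FK sub-lane `prim-bschramm-fk-3` (gen 15); builds on p205010 (kernel theorem,
internal audit signed; external expert review pending).  Pure real algebra on top of `FKThreeApexT5Final` (`InK.uCond`): no measures,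
no named facts, no sorries; standard axioms.

`InK.uCond` gives `(U_a)`: `Φ_a(w₁,w₂)(Z) = (w₁+w₂)(w₁ N^{(ab)} + w₂ N^{(ac)}) − w₁w₂ M_a ≥ 0` on the monoid for all `w₁, w₂ ≥ 0`.  The outer set
`K'' = {Λ ≥ 0, caps, Φ_a^{nat} ≥ 0, Φ_b^{nat} ≥ 0, N ≥ 0, (S)}` on which the T3 forms are certified non-negative (memo `T3-STRUCTURE.md` §7–§8:
a Positivstellensatz certificate exists for `q ∈ [1/2, 1]`) uses the apex-`b` analogue and the NATURAL WEIGHTS of the two marked leaves: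
* `phiB q w₁ w₂ Z := (w₁+w₂)(w₁ N^{(ab)}(Z) + w₂ N^{(bc)}(Z)) − w₁w₂ M_b(Z)`, `M_b = (Z_ab+Z_bc+qZ_0)(Z_ab+Z_bc+Z_1)`; **`phiB_eq_uForm_swapAB`**:
  `phiB q w₁ w₂ Z = uForm q w₁ w₂ (swapAB Z)`; hence **`InK.phiB_nonneg`** (`(U_b)` on the monoid) from `InK.swapAB` and `InK.uCond`;
* **`InK.phiA_nat_nonneg`**: `Φ_a(c₁(1−b₁), b₁(1−c₁)) ≥ 0` (leaf `u₁` at `a` with free probabilities `b₁, c₁`: weight of "attached to `c` only"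
  pairs `N^{(ab)}`, "attached to `b` only" pairs `N^{(ac)}` — the instance of T5's identity), and **`InK.phiB_nat_nonneg`**:
  `Φ_b(c₂(1−a₂), a₂(1−c₂)) ≥ 0` for the leaf `u₂` at `b`.
[cite: Grimmett2006, §3.9 eq. (3.94) (pp. 63–64)] [folklore]
-/

noncomputable section

namespace Summit.CriticalPhenomena.PercolationContinuityZ3.Theorems

namespace FK

namespace ThreeApex

/-- `M_b = (Z_ab + Z_bc + qZ_0)(Z_ab + Z_bc + Z_1)` (in hat coordinates `(x̂ + ẑ − (2−q)û)(v̂ − ŷ)`). [folklore] -/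
def massB (q : ℝ) (Z : V5) : ℝ := (Z.zab + Z.zbc + q * Z.z0) * (Z.zab + Z.zbc + Z.z1)

/-- The apex-`b` upper-envelope form `Φ_b(w₁,w₂)(Z) = (w₁+w₂)(w₁ N^{(ab)} + w₂ N^{(bc)}) − w₁ w₂ M_b`. [folklore] -/
def phiB (q w₁ w₂ : ℝ) (Z : V5) : ℝ :=
  (w₁ + w₂) * (w₁ * masterN q (swapBC Z) + w₂ * masterN q (swapAB Z)) - w₁ * w₂ * massB q Z

/-- `M_a` of the `a ↔ b` relabelling is `M_b`. [folklore] -/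
theorem massA_swapAB (q : ℝ) (Z : V5) : massA q (swapAB Z) = massB q Z := by
  simp only [massA, massB, swapAB]

/-- `N^{(ab)}` is invariant under the `a ↔ b` relabelling. [folklore] -/
theorem masterNab_swapAB (q : ℝ) (Z : V5) : masterN q (swapBC (swapAB Z)) = masterN q (swapBC Z) := by
  simp only [masterN, swapBC, swapAB]; ring

/-- **`Φ_b` is `Φ_a` of the `a ↔ b` relabelling.** [folklore] -/
theorem phiB_eq_uForm_swapAB (q w₁ w₂ : ℝ) (Z : V5) : phiB q w₁ w₂ Z = uForm q w₁ w₂ (swapAB Z) := by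
  simp only [phiB, uForm, massA_swapAB, masterNab_swapAB]

/-- `M_b` in hat coordinates: `(x̂ + ẑ − (2−q)û)(v̂ − ŷ)`. [folklore] -/
theorem massB_hat (q : ℝ) (Z : V5) : massB q Z = (hx Z + hz Z - (2 - q) * Z.z0) * (Z.total - hy Z) := by
  simp only [massB, hx, hy, hz, V5.total]; ring

/-- **`(U_b)` on the three-apex monoid**: `Φ_b(w₁,w₂)(Z) ≥ 0` for all `w₁, w₂ ≥ 0`, `Z ∈ InK q`, `0 < q ≤ 1`. [folklore] -/
theorem InK.phiB_nonneg {q : ℝ} (hq0 : 0 < q) (hq1 : q ≤ 1) {Z : V5} (h : InK q Z) {w₁ w₂ : ℝ} (hw₁ : 0 ≤ w₁) (hw₂ : 0 ≤ w₂) :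
    0 ≤ phiB q w₁ w₂ Z := by
  rw [phiB_eq_uForm_swapAB]
  exact h.swapAB.uCond hq0 hq1 w₁ w₂ hw₁ hw₂

/-- **Natural-weight instance of `(U_a)`** for the marked leaf `u₁` at `a` (free probabilities `b₁, c₁ ∈ [0,1]`):
`Φ_a(c₁(1−b₁), b₁(1−c₁))(Z) ≥ 0` on the monoid — the generator `Φ_a^{nat}` of the outer set `K''`. [folklore] -/
theorem InK.phiA_nat_nonneg {q b₁ c₁ : ℝ} (hq0 : 0 < q) (hq1 : q ≤ 1) (hb0 : 0 ≤ b₁) (hb1 : b₁ ≤ 1) (hc0 : 0 ≤ c₁) (hc1 : c₁ ≤ 1)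
    {Z : V5} (h : InK q Z) : 0 ≤ uForm q (c₁ * (1 - b₁)) (b₁ * (1 - c₁)) Z := by
  have hb' : 0 ≤ 1 - b₁ := sub_nonneg.2 hb1
  have hc' : 0 ≤ 1 - c₁ := sub_nonneg.2 hc1
  exact h.uCond hq0 hq1 _ _ (mul_nonneg hc0 hb') (mul_nonneg hb0 hc')

/-- **Natural-weight instance of `(U_b)`** for the marked leaf `u₂` at `b` (free probabilities `a₂` to `a`, `c₂` to `c`):
`Φ_b(c₂(1−a₂), a₂(1−c₂))(Z) ≥ 0` on the monoid — the generator `Φ_b^{nat}` of the outer set `K''`. [folklore] -/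
theorem InK.phiB_nat_nonneg {q a₂ c₂ : ℝ} (hq0 : 0 < q) (hq1 : q ≤ 1) (ha0 : 0 ≤ a₂) (ha1 : a₂ ≤ 1) (hc0 : 0 ≤ c₂) (hc1 : c₂ ≤ 1)
    {Z : V5} (h : InK q Z) : 0 ≤ phiB q (c₂ * (1 - a₂)) (a₂ * (1 - c₂)) Z := by
  have ha' : 0 ≤ 1 - a₂ := sub_nonneg.2 ha1
  have hc' : 0 ≤ 1 - c₂ := sub_nonneg.2 hc1
  exact h.phiB_nonneg hq0 hq1 (mul_nonneg hc0 ha') (mul_nonneg ha0 hc')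

/-- `Φ_b` as a quadratic form in the weights with the apex-`b` Harris defect `J_b = ŷ(x̂+ẑ−û) − ûv̂`:
`Φ_b(w₁,w₂) = w₁² N^{(ab)} + w₂² N^{(bc)} + w₁w₂(2−q)J_b`. [folklore] -/
theorem phiB_eq (q w₁ w₂ : ℝ) (Z : V5) :
    phiB q w₁ w₂ Z = w₁ ^ 2 * masterN q (swapBC Z) + w₂ ^ 2 * masterN q (swapAB Z)
      + w₁ * w₂ * ((2 - q) * (hy Z * (hx Z + hz Z - Z.z0) - Z.z0 * Z.total)) := by
  simp only [phiB, massB, masterN, swapBC, swapAB, hx, hy, hz, V5.total]; ring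

end ThreeApex

end FK

end Summit.CriticalPhenomena.PercolationContinuityZ3.Theorems
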